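import Summits.HubbardSuperconductivity.HubbardSuperconductivity.Theses.FunctionFieldCertificate
import Summits.HubbardSuperconductivity.HubbardSuperconductivity.Theorems.FunctionFieldCertificateMesoscopicPairOrderProfilePosition
import HarnessLib

/-!
# `MesoscopicPairOrder` (stmt-HubbardSuperconductivity-7331), line `redirect_birth`, stub (Flat)
# `stub_offWindowFlatOnBox`: the POINTWISE glue C⁺_λ ∧ (Ch) ⇒ (Flat), down to one momentum

Helper for stub (Flat) `stub_offWindowFlatOnBox` (lead c11, wave 3). The stub — the flat law
`S_ψ(m) ≤ S(η)` off every window `|q_m| > η`, in every normalised `(N_L, S^z = 0)`-sector ground state of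
`hubbardTorus 2 L 1 U`, eventually in even `L`, at every `(U, δ)` of the box `(0,6] × [1/10,3/10]`
(`S_ψ = pairStructureFactor dWaveFormFactor L ψ`, `|q_m|² = momentumNormSq L m`) — is OPEN physics
("no pair-density-wave Bragg peak at a fixed nonzero momentum in any sector ground state") and is NOT
proved or refuted here. The landed `goldstonePairProfile_of_globalPgd_of_chargingFloor`
(`Theorems/…ProfilePosition.lean`) derives sub-crux (A) (hence (Flat), `goldstonePairProfile_iff_shape_and_flat`)
from the ZONE-WIDE energy-form pair-channel Gaussian domination C⁺_λ (the stmt-1089 stub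
`stub_pairGaussianDomination` with its window clause dropped) and the charging floor (Ch)
(`stub_chargingFloor`), both quantified over ALL `U > 0`, `δ ∈ (0,1/2)`. The reshaped line needs (Flat)
on the box only, and the composition `meso_and_summit_of_boxStubs` consumes it at ONE point. This file
re-runs that engine with everything POINTWISE — in `(U, δ)`, and in the momentum label `m`:

* `shapeAtMomentum_of_pgdAtMomentum_of_chargingFloorAt` — **the closure is pointwise in `m`.** Fix `U > 0`,
  `δ ∈ (0,1/2)`, constants `C_χ, c₀, κ ≥ 0` and a charging floor `pairGap ≥ -κ/L` (eventually). Then there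
  are `A ≥ 0` and `L₀`, chosen BEFORE the state and the momentum, such that for every even `L ≥ L₀`, every
  normalised sector ground state `ψ` and every label `m ≠ 0`: C⁺_λ AT THAT ONE `m` (both one-sided
  inequalities, all real source amplitudes `t`, constants `C_χ, c₀`) already gives the Goldstone shape
  `S_ψ(m)·|q_m| ≤ A` at that `m` (`A = 2√((C₁ + C₃C₂)C_χ) + 2κC_χ/π + 2c₀C_χ√(2π²)` from the landed budgets
  F1 `stub_doubleCommBound`, F2 `WcbcsSsbToTorusLRO.stub_pairCommutatorBudget`, F3
  `wib_twoParticleCost_holds`, the landed first variation `stub_pgdFirstVariation` (p96685) and the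
  per-state closure `WindowInfraredBound.goldstoneShape_of_regularisedClosure` fed the zone-covering
  window `η₀ = √(2π²)`, `momentumNormSq_le_two_mul_pi_sq`).
* `offWindowFlatAt_of_offWindowPgdAt_of_chargingFloorAt` — **the weakest input of (Flat) on this engine**:
  at `(U, δ)` and ONE `η > 0`, own-bottom C⁺_λ asked only at the OFF-WINDOW labels `|q_m| > η`, with
  `m`-independent constants `(C_χ, c₀)`, plus (Ch), gives the (Flat)-body at that `η` with
  `S(η) = A/η` (`S_ψ(m) ≤ A/|q_m| < A/η`).
* `globalShapeAt_of_globalPgdAt_of_chargingFloorAt` — zone-wide C⁺_λ at `(U, δ)` + (Ch) ⇒ the window-free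
  Goldstone shape `S_ψ(m)·|q_m| ≤ A` for all `m ≠ 0` there, i.e. the (A)-body with `S = 0`
  (and a fortiori the (GS)-body of `stub_pairGoldstoneShapeOnBox` at that point, any window).
* `offWindowFlatAt_of_globalPgdAt_of_chargingFloorAt` (registered one-line form
  `offWindowFlatAtOfGlobalPgdAtOfChargingFloorAt`) — **zone-wide C⁺_λ at `(U,δ)` → (Ch) at `(U,δ)` →
  (Flat)-body at `(U,δ)`**, `S(η) = A/η` (profile with `S = 0`, then `le_of_profile_of_sq_lt`).
* `stub_offWindowFlatOnBox_of_boxGlobalPgd_of_boxChargingFloor` — hence the BOX forms of the two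
  physics inputs imply the registered stub `stub_offWindowFlatOnBox` VERBATIM (the all-`(U,δ)` form is
  the (Flat) half of `goldstonePairProfile_of_globalPgd_of_chargingFloor` via
  `goldstonePairProfile_iff_shape_and_flat`, already in the tree).

Audit value. (Flat) at a fixed off-window momentum needs C⁺_λ ONLY AT THAT momentum: a refutation of
(Flat) at `(U, δ, η)` (a sector ground state with `S_ψ(Q) → ∞` along `L` at some `|q_Q| > η`) refutes
own-bottom Gaussian domination AT THAT `Q` with every pair of constants `(C_χ, c₀)` (given (Ch)), and
nothing at small momenta. `S(η) = A/η` blows up as `η → 0`, consistently with a `1/|q|` Goldstone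
profile; the a-priori single-mode bound is only `S_ψ(m) ≤ 32L²` (`InfraredCompletion.pairStructureFactor_le_sumRule`).
NOT here: any claim of C⁺_λ (zone-wide or windowed) or of (Ch) — both OPEN physics (no reflection
positivity off half filling; `pairGap ≥ -κ/L` has no proof at fixed `U > 0`); any statement about the
neighbouring stubs (GS), (Q), (D). No definition, no named fact, no sorry.

Sources: Kennedy–Lieb–Shastry, PRL 61 (1988) 2582, eqs. (17)–(19) (Gaussian domination ⇒ infrared
bound, mode by mode); Dyson–Lieb–Simon, J. Stat. Phys. 18 (1978) 335; Pitaevskii–Stringari, J. Low Temp.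
Phys. 85 (1991) 377 (moment inequality). Folklore bookkeeping over landed theorems.
-/

noncomputable section

-- the summit namespace repeats the problem name by design (D-0017)
set_option linter.dupNamespace false

namespace Summit.HubbardSuperconductivity.HubbardSuperconductivity.Theorems.FunctionFieldCertificate

open Matrix Finset Filter
open Literature.Probability.LatticeModels Literature.MathematicalPhysics.QuantumLattice
open Summit.HubbardSuperconductivity.HubbardSuperconductivity.Theses.FunctionFieldCertificate
open scoped ComplexOrder ComplexConjugate

/-! ### The closure is pointwise in the momentum label -/

/-- **C⁺_λ at ONE momentum ⇒ the Goldstone shape at that momentum** (constants chosen first). Fix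
`U > 0`, `δ ∈ (0,1/2)`, `C_χ, c₀, κ ≥ 0` and the charging floor `pairGap H N_L ≥ -κ/L` for even `L ≥ L_C`.
There are `A ≥ 0`, `L₀` such that for every even `L ≥ L₀`, every normalised `(N_L,0)`-sector ground state
`ψ` of `H = hubbardTorus 2 L 1 U` and every `m ≠ 0`: if the two one-sided own-bottom `λ_q`-regularised
energy-form Gaussian-domination inequalities hold AT THIS `m` for all real `t` (`X = C_χL²/|q_m|²`,
`λ = c₀|q_m|²`), then `S_ψ(m)·|q_m| ≤ A`. Here `A = 2√((C₁ + C₃C₂)C_χ) + 2κC_χ/π + 2c₀C_χ√(2π²)` and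
`L₀ = max L_C (max L₃ 2)` (F1/F2/F3 budgets, first variation p96685, closure
`goldstoneShape_of_regularisedClosure` at the zone-covering window `√(2π²)`). Kennedy–Lieb–Shastry (1988)
eqs. (17)–(19); Pitaevskii–Stringari (1991). [folklore] -/
theorem shapeAtMomentum_of_pgdAtMomentum_of_chargingFloorAt {U δ C_χ c₀ κ : ℝ} {L_C : ℕ} (hU : 0 < U)
    (hδ : δ ∈ Set.Ioo (0:ℝ) (1 / 2)) (hCχ : 0 ≤ C_χ) (hc₀ : 0 ≤ c₀) (hκ : 0 ≤ κ)
    (hCh : ∀ (L : ℕ) [NeZero L], L_C ≤ L → Even L →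
      -(κ / (L : ℝ)) ≤ pairGap (hubbardTorus 2 L 1 U) (2 * ⌊(1 - δ) * (L : ℝ) ^ 2 / 2⌋₊)) :
    ∃ A : ℝ, 0 ≤ A ∧ ∃ L₀ : ℕ, ∀ (L : ℕ) [NeZero L], L₀ ≤ L → Even L →
      ∀ ψ : Fock (Orb (FermionTorus 2 L)), star ψ ⬝ᵥ ψ = 1 →
        IsGroundStateInSector (hubbardTorus 2 L 1 U) (2 * ⌊(1 - δ) * (L : ℝ) ^ 2 / 2⌋₊) 0 ψ →
          ∀ m : TorusSite 2 L, m ≠ 0 →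
            (∀ t : ℝ,
              ((hubbardTorus 2 L 1 U).minEnergyOn (szSector (2 * ⌊(1 - δ) * (L : ℝ) ^ 2 / 2⌋₊) 0) -
                  ((hubbardTorus 2 L 1 U).minEnergyOn (szSector (2 * ⌊(1 - δ) * (L : ℝ) ^ 2 / 2⌋₊) 0) -
                      (hubbardTorus 2 L 1 U).minEnergyOn
                        (szSector (2 * ⌊(1 - δ) * (L : ℝ) ^ 2 / 2⌋₊ - 2) 0) +
                      c₀ * momentumNormSq L m) / 2 * ((2 * ⌊(1 - δ) * (L : ℝ) ^ 2 / 2⌋₊ : ℕ) : ℝ) -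
                  C_χ * (L : ℝ) ^ 2 / momentumNormSq L m * t ^ 2 ≤
                (hubbardTorus 2 L 1 U -
                  ((((hubbardTorus 2 L 1 U).minEnergyOn (szSector (2 * ⌊(1 - δ) * (L : ℝ) ^ 2 / 2⌋₊) 0) -
                      (hubbardTorus 2 L 1 U).minEnergyOn
                        (szSector (2 * ⌊(1 - δ) * (L : ℝ) ^ 2 / 2⌋₊ - 2) 0) +
                      c₀ * momentumNormSq L m) / 2 : ℝ) : ℂ) •
                    (totalNumber :
                      Matrix (Finset (Orb (FermionTorus 2 L))) (Finset (Orb (FermionTorus 2 L))) ℂ) -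
                  (t : ℂ) • (pairFieldAt dWaveFormFactor L m +
                    (pairFieldAt dWaveFormFactor L m)ᴴ)).minEnergyOn
                  (szSector (2 * ⌊(1 - δ) * (L : ℝ) ^ 2 / 2⌋₊ - 2) 0 ⊔
                    szSector (2 * ⌊(1 - δ) * (L : ℝ) ^ 2 / 2⌋₊) 0)) ∧
              ((hubbardTorus 2 L 1 U).minEnergyOn (szSector (2 * ⌊(1 - δ) * (L : ℝ) ^ 2 / 2⌋₊) 0) -
                  ((hubbardTorus 2 L 1 U).minEnergyOn
                        (szSector (2 * ⌊(1 - δ) * (L : ℝ) ^ 2 / 2⌋₊ + 2) 0) -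
                      (hubbardTorus 2 L 1 U).minEnergyOn (szSector (2 * ⌊(1 - δ) * (L : ℝ) ^ 2 / 2⌋₊) 0) -
                      c₀ * momentumNormSq L m) / 2 * ((2 * ⌊(1 - δ) * (L : ℝ) ^ 2 / 2⌋₊ : ℕ) : ℝ) -
                  C_χ * (L : ℝ) ^ 2 / momentumNormSq L m * t ^ 2 ≤
                (hubbardTorus 2 L 1 U -
                  ((((hubbardTorus 2 L 1 U).minEnergyOn
                        (szSector (2 * ⌊(1 - δ) * (L : ℝ) ^ 2 / 2⌋₊ + 2) 0) -
                      (hubbardTorus 2 L 1 U).minEnergyOn (szSector (2 * ⌊(1 - δ) * (L : ℝ) ^ 2 / 2⌋₊) 0) -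
                      c₀ * momentumNormSq L m) / 2 : ℝ) : ℂ) •
                    (totalNumber :
                      Matrix (Finset (Orb (FermionTorus 2 L))) (Finset (Orb (FermionTorus 2 L))) ℂ) -
                  (t : ℂ) • (pairFieldAt dWaveFormFactor L m +
                    (pairFieldAt dWaveFormFactor L m)ᴴ)).minEnergyOn
                  (szSector (2 * ⌊(1 - δ) * (L : ℝ) ^ 2 / 2⌋₊) 0 ⊔
                    szSector (2 * ⌊(1 - δ) * (L : ℝ) ^ 2 / 2⌋₊ + 2) 0))) →
            pairStructureFactor dWaveFormFactor L ψ m * Real.sqrt (momentumNormSq L m) ≤ A := by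
  -- adapted from `goldstonePairProfile_of_globalPgd_of_chargingFloor` (ProfilePosition) with `(U, δ)`
  -- fixed and the Gaussian-domination hypothesis moved AFTER the choice of `A`, `L₀`, `ψ`, `m`
  obtain ⟨η, hη, hηsq⟩ : ∃ η : ℝ, 0 < η ∧ η ^ 2 = 2 * Real.pi ^ 2 :=
    ⟨Real.sqrt (2 * Real.pi ^ 2), Real.sqrt_pos.2 (by positivity), Real.sq_sqrt (by positivity)⟩
  obtain ⟨C₃, hC₃, L₃, hF3⟩ := wib_twoParticleCost_holds U hU δ hδ
  obtain ⟨C, hC, hB⟩ := stub_doubleCommBound U hU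
  obtain ⟨B, hB0, hPCB⟩ := WcbcsSsbToTorusLRO.stub_pairCommutatorBudget
  refine ⟨2 * Real.sqrt ((C + C₃ * B) * C_χ) + 2 * κ * C_χ / Real.pi + 2 * c₀ * C_χ * η,
    by positivity, max L_C (max L₃ 2), fun L _ hL₀ hev ψ hψ1 hψ m hm0 hGD => ?_⟩
  have hLC : L_C ≤ L := le_of_max_le_left hL₀
  have hL₃ : L₃ ≤ L := le_trans (le_max_left _ _) (le_of_max_le_right hL₀)
  have hL2 : 2 ≤ L := le_trans (le_max_right _ _) (le_of_max_le_right hL₀)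
  have hN : 2 ≤ 2 * ⌊(1 - δ) * (L : ℝ) ^ 2 / 2⌋₊ := wib_two_le_summitFilling hδ hL2
  -- the zone-covering window: `|q_m|² ≤ 2π² = η²` for every label
  have hmη : momentumNormSq L m ≤ η ^ 2 := hηsq ▸ momentumNormSq_le_two_mul_pi_sq m
  -- C⁺_λ at this `L`, this `m`, all `t`; first variation (p96685) ⇒ (T_λ∓)
  obtain ⟨hTm, hTp⟩ := WindowInfraredBound.stub_pgdFirstVariation L U
    (2 * ⌊(1 - δ) * (L : ℝ) ^ 2 / 2⌋₊) hN ψ hψ hψ1 m (C_χ * (L : ℝ) ^ 2 / momentumNormSq L m)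
    (c₀ * momentumNormSq L m)
  have hTm' := hTm (fun t => (hGD t).1)
  have hTp' := hTp (fun t => (hGD t).2)
  -- (F1) at `μ = 0`
  have hF1 : (star ψ ⬝ᵥ (((pairFieldAt dWaveFormFactor L m)ᴴ *
        (hubbardTorus 2 L 1 U * pairFieldAt dWaveFormFactor L m -
          pairFieldAt dWaveFormFactor L m * hubbardTorus 2 L 1 U) -
        (hubbardTorus 2 L 1 U * pairFieldAt dWaveFormFactor L m -
          pairFieldAt dWaveFormFactor L m * hubbardTorus 2 L 1 U) *
        (pairFieldAt dWaveFormFactor L m)ᴴ) *ᵥ ψ)).re ≤ C * (L : ℝ) ^ 2 := by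
    have h := hB L 0 m ψ
    rw [hubbardTorusWith_zero, hψ1, Complex.one_re, mul_one, abs_zero, add_zero, mul_one] at h
    exact (le_abs_self _).trans h
  -- (F2)
  have hF2 : |(star ψ ⬝ᵥ (((pairFieldAt dWaveFormFactor L m)ᴴ * pairFieldAt dWaveFormFactor L m -
        pairFieldAt dWaveFormFactor L m * (pairFieldAt dWaveFormFactor L m)ᴴ) *ᵥ ψ)).re| ≤
        B * (L : ℝ) ^ 2 := by
    have h := hPCB L m ψ
    rwa [hψ1, Complex.one_re, mul_one] at h
  exact WindowInfraredBound.goldstoneShape_of_regularisedClosure hN hψ hψ1 hm0 hCχ hC hB0 hC₃ hκ hc₀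
    hmη hη hTm' hTp' hF1 hF2 (hF3 L hL₃ hev) (hCh L hLC hev)

/-! ### The weakest input of (Flat) on this engine: off-window C⁺_λ only -/

/-- **Off-window C⁺_λ ∧ (Ch) ⇒ the (Flat)-body at that `η`, `S(η) = A/η`.** At `U > 0`, `δ ∈ (0,1/2)` and
ONE `η > 0`: if own-bottom energy-form Gaussian domination holds, with `m`-INDEPENDENT constants
`(C_χ, c₀)`, eventually in even `L`, at every OFF-WINDOW label `|q_m| > η` only (all real `t`), and the
charging floor `pairGap ≥ -κ/L` holds eventually, then every normalised `(N_L,0)`-sector ground state has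
`S_ψ(m) ≤ A/η` for `|q_m| > η`, eventually (`S_ψ(m)·|q_m| ≤ A` at each such `m` by
`shapeAtMomentum_of_pgdAtMomentum_of_chargingFloorAt`, and `|q_m| > η`; such `m` are automatically `≠ 0`). So a failure of
(Flat) at `(U, δ, η)` refutes C⁺_λ at the offending off-window momentum itself (given (Ch)). [folklore] -/
theorem offWindowFlatAt_of_offWindowPgdAt_of_chargingFloorAt {U δ η : ℝ} (hU : 0 < U)
    (hδ : δ ∈ Set.Ioo (0:ℝ) (1 / 2)) (hη : 0 < η)
    (hGD : ∃ C_χ c₀ : ℝ, 0 ≤ C_χ ∧ 0 ≤ c₀ ∧ ∃ L₀ : ℕ, ∀ (L : ℕ) [NeZero L], L₀ ≤ L → Even L →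
      ∀ m : TorusSite 2 L, η ^ 2 < momentumNormSq L m → ∀ t : ℝ,
        ((hubbardTorus 2 L 1 U).minEnergyOn (szSector (2 * ⌊(1 - δ) * (L : ℝ) ^ 2 / 2⌋₊) 0) -
            ((hubbardTorus 2 L 1 U).minEnergyOn (szSector (2 * ⌊(1 - δ) * (L : ℝ) ^ 2 / 2⌋₊) 0) -
                (hubbardTorus 2 L 1 U).minEnergyOn (szSector (2 * ⌊(1 - δ) * (L : ℝ) ^ 2 / 2⌋₊ - 2) 0) +
                c₀ * momentumNormSq L m) / 2 * ((2 * ⌊(1 - δ) * (L : ℝ) ^ 2 / 2⌋₊ : ℕ) : ℝ) -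
            C_χ * (L : ℝ) ^ 2 / momentumNormSq L m * t ^ 2 ≤
          (hubbardTorus 2 L 1 U -
            ((((hubbardTorus 2 L 1 U).minEnergyOn (szSector (2 * ⌊(1 - δ) * (L : ℝ) ^ 2 / 2⌋₊) 0) -
                (hubbardTorus 2 L 1 U).minEnergyOn (szSector (2 * ⌊(1 - δ) * (L : ℝ) ^ 2 / 2⌋₊ - 2) 0) +
                c₀ * momentumNormSq L m) / 2 : ℝ) : ℂ) •
              (totalNumber : Matrix (Finset (Orb (FermionTorus 2 L))) (Finset (Orb (FermionTorus 2 L))) ℂ) -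
            (t : ℂ) • (pairFieldAt dWaveFormFactor L m + (pairFieldAt dWaveFormFactor L m)ᴴ)).minEnergyOn
            (szSector (2 * ⌊(1 - δ) * (L : ℝ) ^ 2 / 2⌋₊ - 2) 0 ⊔
              szSector (2 * ⌊(1 - δ) * (L : ℝ) ^ 2 / 2⌋₊) 0)) ∧
        ((hubbardTorus 2 L 1 U).minEnergyOn (szSector (2 * ⌊(1 - δ) * (L : ℝ) ^ 2 / 2⌋₊) 0) -
            ((hubbardTorus 2 L 1 U).minEnergyOn (szSector (2 * ⌊(1 - δ) * (L : ℝ) ^ 2 / 2⌋₊ + 2) 0) -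
                (hubbardTorus 2 L 1 U).minEnergyOn (szSector (2 * ⌊(1 - δ) * (L : ℝ) ^ 2 / 2⌋₊) 0) -
                c₀ * momentumNormSq L m) / 2 * ((2 * ⌊(1 - δ) * (L : ℝ) ^ 2 / 2⌋₊ : ℕ) : ℝ) -
            C_χ * (L : ℝ) ^ 2 / momentumNormSq L m * t ^ 2 ≤
          (hubbardTorus 2 L 1 U -
            ((((hubbardTorus 2 L 1 U).minEnergyOn (szSector (2 * ⌊(1 - δ) * (L : ℝ) ^ 2 / 2⌋₊ + 2) 0) -
                (hubbardTorus 2 L 1 U).minEnergyOn (szSector (2 * ⌊(1 - δ) * (L : ℝ) ^ 2 / 2⌋₊) 0) -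
                c₀ * momentumNormSq L m) / 2 : ℝ) : ℂ) •
              (totalNumber : Matrix (Finset (Orb (FermionTorus 2 L))) (Finset (Orb (FermionTorus 2 L))) ℂ) -
            (t : ℂ) • (pairFieldAt dWaveFormFactor L m + (pairFieldAt dWaveFormFactor L m)ᴴ)).minEnergyOn
            (szSector (2 * ⌊(1 - δ) * (L : ℝ) ^ 2 / 2⌋₊) 0 ⊔
              szSector (2 * ⌊(1 - δ) * (L : ℝ) ^ 2 / 2⌋₊ + 2) 0)))
    (hCh : ∃ κ : ℝ, 0 ≤ κ ∧ ∃ L₀ : ℕ, ∀ (L : ℕ) [NeZero L], L₀ ≤ L → Even L →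
      -(κ / (L : ℝ)) ≤ pairGap (hubbardTorus 2 L 1 U) (2 * ⌊(1 - δ) * (L : ℝ) ^ 2 / 2⌋₊)) :
    ∃ S : ℝ, 0 ≤ S ∧ ∃ L₀ : ℕ, ∀ (L : ℕ) [NeZero L], L₀ ≤ L → Even L →
      ∀ ψ : Fock (Orb (FermionTorus 2 L)), star ψ ⬝ᵥ ψ = 1 →
        IsGroundStateInSector (hubbardTorus 2 L 1 U) (2 * ⌊(1 - δ) * (L : ℝ) ^ 2 / 2⌋₊) 0 ψ →
          ∀ m : TorusSite 2 L, η ^ 2 < momentumNormSq L m →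
            pairStructureFactor dWaveFormFactor L ψ m ≤ S := by
  obtain ⟨C_X, c₀, hCX, hc₀, L_G, hGD⟩ := hGD
  obtain ⟨κ, hκ, L_C, hCh⟩ := hCh
  obtain ⟨A, hA, L_A, hshape⟩ := shapeAtMomentum_of_pgdAtMomentum_of_chargingFloorAt hU hδ hCX hc₀ hκ hCh
  refine ⟨A / η, by positivity, max L_A L_G, fun L _ hL hev ψ hψ1 hψ m hq => ?_⟩
  have hm0 : m ≠ 0 := by
    rintro rfl
    rw [momentumNormSq_zero] at hq
    nlinarith [sq_nonneg η]
  have hr : η < Real.sqrt (momentumNormSq L m) := by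
    rw [← Real.sqrt_sq hη.le]
    exact Real.sqrt_lt_sqrt (sq_nonneg _) hq
  have h := hshape L (le_of_max_le_left hL) hev ψ hψ1 hψ m hm0
    (hGD L (le_of_max_le_right hL) hev m hq)
  rw [← le_div_iff₀ (hη.trans hr)] at h
  exact h.trans (div_le_div_of_nonneg_left hA hη hr.le)

/-! ### Zone-wide C⁺_λ at a point -/

/-- **Zone-wide C⁺_λ ∧ (Ch) at `(U, δ)` ⇒ the window-free Goldstone shape there.** If at `U > 0`,
`δ ∈ (0,1/2)` the energy-form Gaussian domination holds at EVERY label `m ≠ 0` (eventually in even `L`, all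
real `t`) and the charging floor holds, then `S_ψ(m)·|q_m| ≤ A` for all `m ≠ 0`, every normalised sector
ground state, eventually: the (A)-body with `S = 0` at that point (`goldstonePairProfile_iff_globalShape`),
which contains both the (GS)-body (any window) and the (Flat)-body there. [folklore] -/
theorem globalShapeAt_of_globalPgdAt_of_chargingFloorAt {U δ : ℝ} (hU : 0 < U)
    (hδ : δ ∈ Set.Ioo (0:ℝ) (1 / 2))
    (hGD : ∃ C_χ c₀ : ℝ, 0 ≤ C_χ ∧ 0 ≤ c₀ ∧ ∃ L₀ : ℕ, ∀ (L : ℕ) [NeZero L], L₀ ≤ L → Even L →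
      ∀ m : TorusSite 2 L, m ≠ 0 → ∀ t : ℝ,
        ((hubbardTorus 2 L 1 U).minEnergyOn (szSector (2 * ⌊(1 - δ) * (L : ℝ) ^ 2 / 2⌋₊) 0) -
            ((hubbardTorus 2 L 1 U).minEnergyOn (szSector (2 * ⌊(1 - δ) * (L : ℝ) ^ 2 / 2⌋₊) 0) -
                (hubbardTorus 2 L 1 U).minEnergyOn (szSector (2 * ⌊(1 - δ) * (L : ℝ) ^ 2 / 2⌋₊ - 2) 0) +
                c₀ * momentumNormSq L m) / 2 * ((2 * ⌊(1 - δ) * (L : ℝ) ^ 2 / 2⌋₊ : ℕ) : ℝ) -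
            C_χ * (L : ℝ) ^ 2 / momentumNormSq L m * t ^ 2 ≤
          (hubbardTorus 2 L 1 U -
            ((((hubbardTorus 2 L 1 U).minEnergyOn (szSector (2 * ⌊(1 - δ) * (L : ℝ) ^ 2 / 2⌋₊) 0) -
                (hubbardTorus 2 L 1 U).minEnergyOn (szSector (2 * ⌊(1 - δ) * (L : ℝ) ^ 2 / 2⌋₊ - 2) 0) +
                c₀ * momentumNormSq L m) / 2 : ℝ) : ℂ) •
              (totalNumber : Matrix (Finset (Orb (FermionTorus 2 L))) (Finset (Orb (FermionTorus 2 L))) ℂ) -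
            (t : ℂ) • (pairFieldAt dWaveFormFactor L m + (pairFieldAt dWaveFormFactor L m)ᴴ)).minEnergyOn
            (szSector (2 * ⌊(1 - δ) * (L : ℝ) ^ 2 / 2⌋₊ - 2) 0 ⊔
              szSector (2 * ⌊(1 - δ) * (L : ℝ) ^ 2 / 2⌋₊) 0)) ∧
        ((hubbardTorus 2 L 1 U).minEnergyOn (szSector (2 * ⌊(1 - δ) * (L : ℝ) ^ 2 / 2⌋₊) 0) -
            ((hubbardTorus 2 L 1 U).minEnergyOn (szSector (2 * ⌊(1 - δ) * (L : ℝ) ^ 2 / 2⌋₊ + 2) 0) -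
                (hubbardTorus 2 L 1 U).minEnergyOn (szSector (2 * ⌊(1 - δ) * (L : ℝ) ^ 2 / 2⌋₊) 0) -
                c₀ * momentumNormSq L m) / 2 * ((2 * ⌊(1 - δ) * (L : ℝ) ^ 2 / 2⌋₊ : ℕ) : ℝ) -
            C_χ * (L : ℝ) ^ 2 / momentumNormSq L m * t ^ 2 ≤
          (hubbardTorus 2 L 1 U -
            ((((hubbardTorus 2 L 1 U).minEnergyOn (szSector (2 * ⌊(1 - δ) * (L : ℝ) ^ 2 / 2⌋₊ + 2) 0) -
                (hubbardTorus 2 L 1 U).minEnergyOn (szSector (2 * ⌊(1 - δ) * (L : ℝ) ^ 2 / 2⌋₊) 0) -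
                c₀ * momentumNormSq L m) / 2 : ℝ) : ℂ) •
              (totalNumber : Matrix (Finset (Orb (FermionTorus 2 L))) (Finset (Orb (FermionTorus 2 L))) ℂ) -
            (t : ℂ) • (pairFieldAt dWaveFormFactor L m + (pairFieldAt dWaveFormFactor L m)ᴴ)).minEnergyOn
            (szSector (2 * ⌊(1 - δ) * (L : ℝ) ^ 2 / 2⌋₊) 0 ⊔
              szSector (2 * ⌊(1 - δ) * (L : ℝ) ^ 2 / 2⌋₊ + 2) 0)))
    (hCh : ∃ κ : ℝ, 0 ≤ κ ∧ ∃ L₀ : ℕ, ∀ (L : ℕ) [NeZero L], L₀ ≤ L → Even L →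
      -(κ / (L : ℝ)) ≤ pairGap (hubbardTorus 2 L 1 U) (2 * ⌊(1 - δ) * (L : ℝ) ^ 2 / 2⌋₊)) :
    ∃ A : ℝ, 0 ≤ A ∧ ∃ L₀ : ℕ, ∀ (L : ℕ) [NeZero L], L₀ ≤ L → Even L →
      ∀ ψ : Fock (Orb (FermionTorus 2 L)), star ψ ⬝ᵥ ψ = 1 →
        IsGroundStateInSector (hubbardTorus 2 L 1 U) (2 * ⌊(1 - δ) * (L : ℝ) ^ 2 / 2⌋₊) 0 ψ →
          ∀ m : TorusSite 2 L, m ≠ 0 →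
            pairStructureFactor dWaveFormFactor L ψ m * Real.sqrt (momentumNormSq L m) ≤ A := by
  obtain ⟨C_X, c₀, hCX, hc₀, L_G, hGD⟩ := hGD
  obtain ⟨κ, hκ, L_C, hCh⟩ := hCh
  obtain ⟨A, hA, L_A, hshape⟩ := shapeAtMomentum_of_pgdAtMomentum_of_chargingFloorAt hU hδ hCX hc₀ hκ hCh
  exact ⟨A, hA, max L_A L_G, fun L _ hL hev ψ hψ1 hψ m hm0 =>
    hshape L (le_of_max_le_left hL) hev ψ hψ1 hψ m hm0 (hGD L (le_of_max_le_right hL) hev m hm0)⟩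

/-- **Zone-wide C⁺_λ at `(U,δ)` → (Ch) at `(U,δ)` → the (Flat)-body at `(U,δ)`** (main theorem; registered
one-line form `offWindowFlatAtOfGlobalPgdAtOfChargingFloorAt`). For FIXED `U > 0`, `δ ∈ (0,1/2)`: the body of
the zone-wide Gaussian-domination hypothesis of `goldstonePairProfile_of_globalPgd_of_chargingFloor` at
`(U, δ)` and the body of `stub_chargingFloor` at `(U, δ)` imply, for every `η > 0`, a flat bound
`S_ψ(m) ≤ S(η)` off the window `|q_m| > η` in every normalised `(N_L,0)`-sector ground state, eventually in
even `L`, with `S(η) = A/η`: the window-free shape (`globalShapeAt_of_globalPgdAt_of_chargingFloorAt`) is the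
profile `S_ψ(m) ≤ 0 + A/|q_m|` (`m ≠ 0`), and `le_of_profile_of_sq_lt` (profile ⇒ flat). Only the labels
`|q_m| > η` of the hypothesis are used (`offWindowFlatAt_of_offWindowPgdAt_of_chargingFloorAt`).
Kennedy–Lieb–Shastry (1988); Pitaevskii–Stringari (1991). [folklore] -/
theorem offWindowFlatAt_of_globalPgdAt_of_chargingFloorAt {U δ : ℝ} (hU : 0 < U)
    (hδ : δ ∈ Set.Ioo (0:ℝ) (1 / 2))
    (hGD : ∃ C_χ c₀ : ℝ, 0 ≤ C_χ ∧ 0 ≤ c₀ ∧ ∃ L₀ : ℕ, ∀ (L : ℕ) [NeZero L], L₀ ≤ L → Even L →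
      ∀ m : TorusSite 2 L, m ≠ 0 → ∀ t : ℝ,
        ((hubbardTorus 2 L 1 U).minEnergyOn (szSector (2 * ⌊(1 - δ) * (L : ℝ) ^ 2 / 2⌋₊) 0) -
            ((hubbardTorus 2 L 1 U).minEnergyOn (szSector (2 * ⌊(1 - δ) * (L : ℝ) ^ 2 / 2⌋₊) 0) -
                (hubbardTorus 2 L 1 U).minEnergyOn (szSector (2 * ⌊(1 - δ) * (L : ℝ) ^ 2 / 2⌋₊ - 2) 0) +
                c₀ * momentumNormSq L m) / 2 * ((2 * ⌊(1 - δ) * (L : ℝ) ^ 2 / 2⌋₊ : ℕ) : ℝ) -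
            C_χ * (L : ℝ) ^ 2 / momentumNormSq L m * t ^ 2 ≤
          (hubbardTorus 2 L 1 U -
            ((((hubbardTorus 2 L 1 U).minEnergyOn (szSector (2 * ⌊(1 - δ) * (L : ℝ) ^ 2 / 2⌋₊) 0) -
                (hubbardTorus 2 L 1 U).minEnergyOn (szSector (2 * ⌊(1 - δ) * (L : ℝ) ^ 2 / 2⌋₊ - 2) 0) +
                c₀ * momentumNormSq L m) / 2 : ℝ) : ℂ) •
              (totalNumber : Matrix (Finset (Orb (FermionTorus 2 L))) (Finset (Orb (FermionTorus 2 L))) ℂ) -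
            (t : ℂ) • (pairFieldAt dWaveFormFactor L m + (pairFieldAt dWaveFormFactor L m)ᴴ)).minEnergyOn
            (szSector (2 * ⌊(1 - δ) * (L : ℝ) ^ 2 / 2⌋₊ - 2) 0 ⊔
              szSector (2 * ⌊(1 - δ) * (L : ℝ) ^ 2 / 2⌋₊) 0)) ∧
        ((hubbardTorus 2 L 1 U).minEnergyOn (szSector (2 * ⌊(1 - δ) * (L : ℝ) ^ 2 / 2⌋₊) 0) -
            ((hubbardTorus 2 L 1 U).minEnergyOn (szSector (2 * ⌊(1 - δ) * (L : ℝ) ^ 2 / 2⌋₊ + 2) 0) -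
                (hubbardTorus 2 L 1 U).minEnergyOn (szSector (2 * ⌊(1 - δ) * (L : ℝ) ^ 2 / 2⌋₊) 0) -
                c₀ * momentumNormSq L m) / 2 * ((2 * ⌊(1 - δ) * (L : ℝ) ^ 2 / 2⌋₊ : ℕ) : ℝ) -
            C_χ * (L : ℝ) ^ 2 / momentumNormSq L m * t ^ 2 ≤
          (hubbardTorus 2 L 1 U -
            ((((hubbardTorus 2 L 1 U).minEnergyOn (szSector (2 * ⌊(1 - δ) * (L : ℝ) ^ 2 / 2⌋₊ + 2) 0) -
                (hubbardTorus 2 L 1 U).minEnergyOn (szSector (2 * ⌊(1 - δ) * (L : ℝ) ^ 2 / 2⌋₊) 0) -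
                c₀ * momentumNormSq L m) / 2 : ℝ) : ℂ) •
              (totalNumber : Matrix (Finset (Orb (FermionTorus 2 L))) (Finset (Orb (FermionTorus 2 L))) ℂ) -
            (t : ℂ) • (pairFieldAt dWaveFormFactor L m + (pairFieldAt dWaveFormFactor L m)ᴴ)).minEnergyOn
            (szSector (2 * ⌊(1 - δ) * (L : ℝ) ^ 2 / 2⌋₊) 0 ⊔
              szSector (2 * ⌊(1 - δ) * (L : ℝ) ^ 2 / 2⌋₊ + 2) 0)))
    (hCh : ∃ κ : ℝ, 0 ≤ κ ∧ ∃ L₀ : ℕ, ∀ (L : ℕ) [NeZero L], L₀ ≤ L → Even L →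
      -(κ / (L : ℝ)) ≤ pairGap (hubbardTorus 2 L 1 U) (2 * ⌊(1 - δ) * (L : ℝ) ^ 2 / 2⌋₊)) :
    ∀ η : ℝ, 0 < η → ∃ S : ℝ, 0 ≤ S ∧ ∃ L₀ : ℕ, ∀ (L : ℕ) [NeZero L], L₀ ≤ L → Even L →
      ∀ ψ : Fock (Orb (FermionTorus 2 L)), star ψ ⬝ᵥ ψ = 1 →
        IsGroundStateInSector (hubbardTorus 2 L 1 U) (2 * ⌊(1 - δ) * (L : ℝ) ^ 2 / 2⌋₊) 0 ψ →
          ∀ m : TorusSite 2 L, η ^ 2 < momentumNormSq L m →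
            pairStructureFactor dWaveFormFactor L ψ m ≤ S := by
  intro η hη
  obtain ⟨A, hA, L₀, hshape⟩ := globalShapeAt_of_globalPgdAt_of_chargingFloorAt hU hδ hGD hCh
  refine ⟨A / η, by positivity, L₀, fun L _ hL hev ψ hψ1 hψ m hq => ?_⟩
  -- the window-free shape is the profile with `S = 0`; profile ⇒ flat off the window (`S(η) = A/η`)
  have h := le_of_profile_of_sq_lt (S := 0) hA hη (pairStructureFactor dWaveFormFactor L ψ)
    (fun m' hm' => ?_) hq
  · rwa [zero_add] at h
  · have hr := sqrt_momentumNormSq_pos hm'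
    have h' := hshape L hL hev ψ hψ1 hψ m' hm'
    rw [← le_div_iff₀ hr] at h'
    rwa [zero_add]

/-- **Registered one-line form** (sub-goal `offWindowFlatAtOfGlobalPgdAtOfChargingFloorAt` of
stmt-7331, line `redirect_birth`, lead c11 wave 3): for fixed `U > 0`, `δ ∈ (0,1/2)`, zone-wide C⁺_λ at
`(U,δ)` → (Ch) at `(U,δ)` → the (Flat)-body at `(U,δ)` (`offWindowFlatAt_of_globalPgdAt_of_chargingFloorAt`).
[folklore] -/
theorem offWindowFlatAtOfGlobalPgdAtOfChargingFloorAt : ∀ U : ℝ, 0 < U → ∀ δ ∈ Set.Ioo (0:ℝ) (1 / 2), (∃ C_χ c₀ : ℝ, 0 ≤ C_χ ∧ 0 ≤ c₀ ∧ ∃ L₀ : ℕ, ∀ (L : ℕ) [NeZero L], L₀ ≤ L → Even L → ∀ m : TorusSite 2 L, m ≠ 0 → ∀ t : ℝ, ((hubbardTorus 2 L 1 U).minEnergyOn (szSector (2 * ⌊(1 - δ) * (L : ℝ) ^ 2 / 2⌋₊) 0) - ((hubbardTorus 2 L 1 U).minEnergyOn (szSector (2 * ⌊(1 - δ) * (L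 : ℝ) ^ 2 / 2⌋₊) 0) - (hubbardTorus 2 L 1 U).minEnergyOn (szSector (2 * ⌊(1 - δ) * (L : ℝ) ^ 2 / 2⌋₊ - 2) 0) + c₀ * momentumNormSq L m) / 2 * ((2 * ⌊(1 - δ) * (L : ℝ) ^ 2 / 2⌋₊ : ℕ) : ℝ) - C_χ * (L : ℝ) ^ 2 / momentumNormSq L m * t ^ 2 ≤ (hubbardTorus 2 L 1 U - ((((hubbardTorus 2 L 1 U).minEnergyOn (szSector (2 * ⌊(1 - δ) * (L : ℝ) ^ 2 / 2⌋₊) 0) - (hubbardTorus 2 L 1 U).minEnergyOn (szSector (2 * ⌊(1 - δ) * (L : ℝ) ^ 2 / 2⌋₊ - 2) 0) + c₀ * momentumNormSq L m) / 2 : ℝ) : ℂ) • (totalNumber : Matrix (Finset (Orb (FermionTorus 2 L))) (Finset (Orb (FermionTorus 2 L))) ℂ) - (t : ℂ) • (pairFieldAt dWaveFormFactor L m + (pairFieldAt dWaveFormFactor L m)ᴴ)).minEnergyOn (szSector (2 * ⌊(1 - δ) * (L : ℝ) ^ 2 / 2⌋₊ - 2) 0 ⊔ szSector (2 * ⌊(1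 - δ) * (L : ℝ) ^ 2 / 2⌋₊) 0)) ∧ ((hubbardTorus 2 L 1 U).minEnergyOn (szSector (2 * ⌊(1 - δ) * (L : ℝ) ^ 2 / 2⌋₊) 0) - ((hubbardTorus 2 L 1 U).minEnergyOn (szSector (2 * ⌊(1 - δ) * (L : ℝ) ^ 2 / 2⌋₊ + 2) 0) - (hubbardTorus 2 L 1 U).minEnergyOn (szSector (2 * ⌊(1 - δ) * (L : ℝ) ^ 2 / 2⌋₊) 0) - c₀ * momentumNormSq L m) / 2 * ((2 * ⌊(1 - δ) * (L : ℝ) ^ 2 / 2⌋₊ : ℕ) : ℝ) - C_χ * (L : ℝ) ^ 2 / momentumNormSq L m * t ^ 2 ≤ (hubbardTorus 2 L 1 U - ((((hubbardTorus 2 L 1 U).minEnergyOn (szSector (2 * ⌊(1 - δ) * (L : ℝ) ^ 2 / 2⌋₊ + 2) 0) - (hubbardTorus 2 L 1 U).minEnergyOn (szSector (2 * ⌊(1 - δ) * (L : ℝ) ^ 2 / 2⌋₊) 0) - c₀ * momentumNormSq L m) / 2 : ℝ) : ℂ) • (totalNumber : Matrix (Finset (Orb (FermionTorus 2 L))) (Finset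 (Orb (FermionTorus 2 L))) ℂ) - (t : ℂ) • (pairFieldAt dWaveFormFactor L m + (pairFieldAt dWaveFormFactor L m)ᴴ)).minEnergyOn (szSector (2 * ⌊(1 - δ) * (L : ℝ) ^ 2 / 2⌋₊) 0 ⊔ szSector (2 * ⌊(1 - δ) * (L : ℝ) ^ 2 / 2⌋₊ + 2) 0))) → (∃ κ : ℝ, 0 ≤ κ ∧ ∃ L₀ : ℕ, ∀ (L : ℕ) [NeZero L], L₀ ≤ L → Even L → -(κ / (L : ℝ)) ≤ pairGap (hubbardTorus 2 L 1 U) (2 * ⌊(1 - δ) * (L : ℝ) ^ 2 / 2⌋₊)) → ∀ η : ℝ, 0 < η → ∃ S : ℝ, 0 ≤ S ∧ ∃ L₀ : ℕ, ∀ (L : ℕ) [NeZero L], L₀ ≤ L → Even L → ∀ ψ : Fock (Orb (FermionTorus 2 L)), star ψ ⬝ᵥ ψ = 1 → IsGroundStateInSector (hubbardTorus 2 L 1 U) (2 * ⌊(1 - δ) * (L : ℝ) ^ 2 / 2⌋₊) 0 ψ → ∀ m : TorusSite 2 L, η ^ 2 < momentumNormSq L m → pairStructureFactor dWaveFormFactor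 L ψ m ≤ S :=
  fun _ hU _ hδ hGD hCh => offWindowFlatAt_of_globalPgdAt_of_chargingFloorAt hU hδ hGD hCh

/-! ### The box forms feed the registered stub -/

/-- **Box zone-wide C⁺_λ → box (Ch) → `stub_offWindowFlatOnBox` VERBATIM.** If the zone-wide energy-form
pair Gaussian domination and the charging floor hold at every point of the box `U ∈ (0,6]`,
`δ ∈ [1/10,3/10]`, then the registered stub (Flat) of line `redirect_birth` holds (its conclusion is copied
verbatim): at each box point `0 < U` and `δ ∈ (0,1/2)`, so `offWindowFlatAt_of_globalPgdAt_of_chargingFloorAt`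
applies. The two hypotheses are OPEN physics and are NOT claimed. [folklore] -/
theorem stub_offWindowFlatOnBox_of_boxGlobalPgd_of_boxChargingFloor
    (hGD : ∀ U : ℝ, U ∈ Set.Ioc (0:ℝ) 6 → ∀ δ : ℝ, δ ∈ Set.Icc (1 / 10 : ℝ) (3 / 10) →
      ∃ C_χ c₀ : ℝ, 0 ≤ C_χ ∧ 0 ≤ c₀ ∧ ∃ L₀ : ℕ, ∀ (L : ℕ) [NeZero L], L₀ ≤ L → Even L →
      ∀ m : TorusSite 2 L, m ≠ 0 → ∀ t : ℝ,
        ((hubbardTorus 2 L 1 U).minEnergyOn (szSector (2 * ⌊(1 - δ) * (L : ℝ) ^ 2 / 2⌋₊) 0) -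
            ((hubbardTorus 2 L 1 U).minEnergyOn (szSector (2 * ⌊(1 - δ) * (L : ℝ) ^ 2 / 2⌋₊) 0) -
                (hubbardTorus 2 L 1 U).minEnergyOn (szSector (2 * ⌊(1 - δ) * (L : ℝ) ^ 2 / 2⌋₊ - 2) 0) +
                c₀ * momentumNormSq L m) / 2 * ((2 * ⌊(1 - δ) * (L : ℝ) ^ 2 / 2⌋₊ : ℕ) : ℝ) -
            C_χ * (L : ℝ) ^ 2 / momentumNormSq L m * t ^ 2 ≤
          (hubbardTorus 2 L 1 U -
            ((((hubbardTorus 2 L 1 U).minEnergyOn (szSector (2 * ⌊(1 - δ) * (L : ℝ) ^ 2 / 2⌋₊) 0) -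
                (hubbardTorus 2 L 1 U).minEnergyOn (szSector (2 * ⌊(1 - δ) * (L : ℝ) ^ 2 / 2⌋₊ - 2) 0) +
                c₀ * momentumNormSq L m) / 2 : ℝ) : ℂ) •
              (totalNumber : Matrix (Finset (Orb (FermionTorus 2 L))) (Finset (Orb (FermionTorus 2 L))) ℂ) -
            (t : ℂ) • (pairFieldAt dWaveFormFactor L m + (pairFieldAt dWaveFormFactor L m)ᴴ)).minEnergyOn
            (szSector (2 * ⌊(1 - δ) * (L : ℝ) ^ 2 / 2⌋₊ - 2) 0 ⊔
              szSector (2 * ⌊(1 - δ) * (L : ℝ) ^ 2 / 2⌋₊) 0)) ∧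
        ((hubbardTorus 2 L 1 U).minEnergyOn (szSector (2 * ⌊(1 - δ) * (L : ℝ) ^ 2 / 2⌋₊) 0) -
            ((hubbardTorus 2 L 1 U).minEnergyOn (szSector (2 * ⌊(1 - δ) * (L : ℝ) ^ 2 / 2⌋₊ + 2) 0) -
                (hubbardTorus 2 L 1 U).minEnergyOn (szSector (2 * ⌊(1 - δ) * (L : ℝ) ^ 2 / 2⌋₊) 0) -
                c₀ * momentumNormSq L m) / 2 * ((2 * ⌊(1 - δ) * (L : ℝ) ^ 2 / 2⌋₊ : ℕ) : ℝ) -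
            C_χ * (L : ℝ) ^ 2 / momentumNormSq L m * t ^ 2 ≤
          (hubbardTorus 2 L 1 U -
            ((((hubbardTorus 2 L 1 U).minEnergyOn (szSector (2 * ⌊(1 - δ) * (L : ℝ) ^ 2 / 2⌋₊ + 2) 0) -
                (hubbardTorus 2 L 1 U).minEnergyOn (szSector (2 * ⌊(1 - δ) * (L : ℝ) ^ 2 / 2⌋₊) 0) -
                c₀ * momentumNormSq L m) / 2 : ℝ) : ℂ) •
              (totalNumber : Matrix (Finset (Orb (FermionTorus 2 L))) (Finset (Orb (FermionTorus 2 L))) ℂ) -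
            (t : ℂ) • (pairFieldAt dWaveFormFactor L m + (pairFieldAt dWaveFormFactor L m)ᴴ)).minEnergyOn
            (szSector (2 * ⌊(1 - δ) * (L : ℝ) ^ 2 / 2⌋₊) 0 ⊔
              szSector (2 * ⌊(1 - δ) * (L : ℝ) ^ 2 / 2⌋₊ + 2) 0)))
    (hCh : ∀ U : ℝ, U ∈ Set.Ioc (0:ℝ) 6 → ∀ δ : ℝ, δ ∈ Set.Icc (1 / 10 : ℝ) (3 / 10) →
      ∃ κ : ℝ, 0 ≤ κ ∧ ∃ L₀ : ℕ, ∀ (L : ℕ) [NeZero L], L₀ ≤ L → Even L →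
        -(κ / (L : ℝ)) ≤ pairGap (hubbardTorus 2 L 1 U) (2 * ⌊(1 - δ) * (L : ℝ) ^ 2 / 2⌋₊)) :
    ∀ U : ℝ, U ∈ Set.Ioc (0:ℝ) 6 → ∀ δ : ℝ, δ ∈ Set.Icc (1 / 10 : ℝ) (3 / 10) →
      ∀ η : ℝ, 0 < η → ∃ S : ℝ, 0 ≤ S ∧ ∃ L₀ : ℕ,
      ∀ (L : ℕ) [NeZero L], L₀ ≤ L → Even L →
        ∀ ψ : Fock (Orb (FermionTorus 2 L)), star ψ ⬝ᵥ ψ = 1 →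
          IsGroundStateInSector (hubbardTorus 2 L 1 U) (2 * ⌊(1 - δ) * (L : ℝ) ^ 2 / 2⌋₊) 0 ψ →
            ∀ m : TorusSite 2 L, η ^ 2 < momentumNormSq L m →
              pairStructureFactor dWaveFormFactor L ψ m ≤ S := by
  intro U hU δ hδ
  have hδ' : δ ∈ Set.Ioo (0:ℝ) (1 / 2) := ⟨by linarith [hδ.1], by linarith [hδ.2]⟩
  exact offWindowFlatAt_of_globalPgdAt_of_chargingFloorAt hU.1 hδ' (hGD U hU δ hδ) (hCh U hU δ hδ)

end Summit.HubbardSuperconductivity.HubbardSuperconductivity.Theorems.FunctionFieldCertificate
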